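import Summits.Ventures.Crystal3D.Theorems.StickyWulffConstantNoReconstructionGainOneOverhangFilm
import Summits.Ventures.Crystal3D.Theorems.StickyWulffConstantNoReconstructionGainTwoOverhangFilm
import Summits.Ventures.Crystal3D.Theorems.StickyWulffConstantNoReconstructionGainWindowBarlowFilmOrbit
import HarnessLib

/-!
# Single-family Barlow films of ANY `{111}` family, both hemispheres: the three closure-form rungs by lattice symmetry

HONEST FRAMING. Part of the venture `Summits/Ventures/Crystal3D` (cell `crystal3d-full`), helper
`--supports` the crux `NoReconstructionGain` (stmt-Ventures-19144, route
`route-Ventures-StickyWulffConstant`), line `adhesion`; continuation of `…NTiltBarlowFilm` (`C = 0`),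
`…OneOverhangFilm` (`C = 1`), `…TwoOverhangFilm` (`C = 2`) — the three position-independent
certificates for films in `B = Λ₀ ∪ (Λ₀ ± w)` in CLOSURE FORM (film-adjacent substrate balls have all
`ν`-downward lattice neighbours in `P`) — and of the transport pattern of `…BasalBarlowFilmOrbit`.

* `closureRung_transport` — generic: a closure-form rung with regime predicate `Reg ν` transports along
  any linear isometry `g` with `g Λ₀ = Λ₀` to films in `g B = Λ₀ ∪ (Λ₀ ± g w)`, regime `Reg (g⁻¹ ν)` and
  the closure list `g d`, `d` one of the twelve bond vectors (pull back by `g⁻¹`;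
  `card_cross_image_of_isometry`, `contactDeficiency_image_of_isometry`);
* `nTiltBarlowFilm_adhesion_orbit`, `oneOverhangBarlowFilm_adhesion_orbit`,
  `twoOverhangBarlowFilm_adhesion_orbit` (**rungs**, registered by name): the three regimes for the
  family `g e₃` (hollow vectors `g w, g (w − u), g (w − v)`, `α = √(2/3) ⟪ν, g e₃⟫`).  With `g = −1`
  they cover the hemisphere `ν₃ ≤ 0` of the basal family; with the lattice rotations, the other three
  families.

So: at EVERY unit normal `ν` and for EVERY one of the four `{111}` families (off the tie circles
`√(2/3)⟪ν, ±g e₃⟫ + ⟪g τ, ν⟫ = 0`), every film on the Barlow positions of that family lying above the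
cut satisfies the atom with `C = 0`, provided the substrate is one-step closed at film contacts.

WHAT THIS IS NOT: the rim term of the slab sample (general-`ν` annulus count owed); films mixing
families (multi-family slot rules: LP evidence only, kit j294974); rung F-C1 not moved.
-/

noncomputable section

namespace Summit.Ventures.Crystal3D.Theorems

open Summit.Ventures.Crystal3D Finset
open Literature.MathematicalPhysics.StatisticalMechanics (barlowPos fccStacking barlowOffset layerNormal constHagg
  contactDeficiency)
open scoped InnerProductSpace

/-- **Transport of a closure-form rung along a lattice symmetry.**  `Reg` is the regime predicate. -/
theorem closureRung_transport (Reg : EuclideanSpace ℝ (Fin 3) → Prop)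
    (hT : ∃ R C : ℝ, 1 ≤ R ∧ ∀ ν : EuclideanSpace ℝ (Fin 3), ‖ν‖ = 1 → ∀ ρ : ℝ, R ≤ ρ →
      ∀ X P : Finset (EuclideanSpace ℝ (Fin 3)),
      (∀ p ∈ X, ∀ q ∈ X, p ≠ q → 1 ≤ dist p q) → P ⊆ X →
      (∀ p, p ∈ P ↔ (p ∈ fccStacking 1 (Real.sqrt (2 / 3)) ∧ -(2 * R) ≤ ⟪p, ν⟫_ℝ ∧
        ⟪p, ν⟫_ℝ ≤ -R ∧ ‖p‖ ^ 2 - ⟪p, ν⟫_ℝ ^ 2 ≤ ρ ^ 2)) →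
      Reg ν →
      (∀ q ∈ X \ P, q ∈ fccStacking 1 (Real.sqrt (2 / 3)) ∨
        q - barlowOffset 1 ∈ fccStacking 1 (Real.sqrt (2 / 3)) ∨
        q + barlowOffset 1 ∈ fccStacking 1 (Real.sqrt (2 / 3))) →
      (∀ q ∈ X \ P, -R < ⟪q, ν⟫_ℝ) →
      (∀ p ∈ P, ∀ q ∈ X \ P, dist p q = 1 →
        ∀ d ∈ ([barlowPos 1 (Real.sqrt (2 / 3)) constHagg 0 1 0, -barlowPos 1 (Real.sqrt (2 / 3)) constHagg 0 1 0,
            barlowPos 1 (Real.sqrt (2 / 3)) constHagg 0 0 1, -barlowPos 1 (Real.sqrt (2 / 3)) constHagg 0 0 1,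
            barlowPos 1 (Real.sqrt (2 / 3)) constHagg 0 1 (-1), -barlowPos 1 (Real.sqrt (2 / 3)) constHagg 0 1 (-1),
            barlowPos 1 (Real.sqrt (2 / 3)) constHagg 1 0 0, -barlowPos 1 (Real.sqrt (2 / 3)) constHagg 1 0 0,
            barlowPos 1 (Real.sqrt (2 / 3)) constHagg (-1) 1 0, -barlowPos 1 (Real.sqrt (2 / 3)) constHagg (-1) 1 0,
            barlowPos 1 (Real.sqrt (2 / 3)) constHagg (-1) 0 1, -barlowPos 1 (Real.sqrt (2 / 3)) constHagg (-1) 0 1] :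
            List (EuclideanSpace ℝ (Fin 3))),
          ⟪d, ν⟫_ℝ < 0 → p + d ∈ P) →
      ((((P ×ˢ (X \ P)).filter fun pq => dist pq.1 pq.2 = 1).card : ℕ) : ℝ) ≤
        contactDeficiency (X \ P) + C * ρ) :
    ∃ R C : ℝ, 1 ≤ R ∧ ∀ ν : EuclideanSpace ℝ (Fin 3), ‖ν‖ = 1 → ∀ ρ : ℝ, R ≤ ρ →
      ∀ X P : Finset (EuclideanSpace ℝ (Fin 3)),
      (∀ p ∈ X, ∀ q ∈ X, p ≠ q → 1 ≤ dist p q) → P ⊆ X →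
      (∀ p, p ∈ P ↔ (p ∈ fccStacking 1 (Real.sqrt (2 / 3)) ∧ -(2 * R) ≤ ⟪p, ν⟫_ℝ ∧
        ⟪p, ν⟫_ℝ ≤ -R ∧ ‖p‖ ^ 2 - ⟪p, ν⟫_ℝ ^ 2 ≤ ρ ^ 2)) →
      ∀ g : EuclideanSpace ℝ (Fin 3) ≃ₗᵢ[ℝ] EuclideanSpace ℝ (Fin 3),
      (∀ p ∈ fccStacking 1 (Real.sqrt (2 / 3)), g p ∈ fccStacking 1 (Real.sqrt (2 / 3))) →
      (∀ p ∈ fccStacking 1 (Real.sqrt (2 / 3)), g.symm p ∈ fccStacking 1 (Real.sqrt (2 / 3))) →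
      Reg (g.symm ν) →
      (∀ q ∈ X \ P, q ∈ fccStacking 1 (Real.sqrt (2 / 3)) ∨
        q - g (barlowOffset 1) ∈ fccStacking 1 (Real.sqrt (2 / 3)) ∨
        q + g (barlowOffset 1) ∈ fccStacking 1 (Real.sqrt (2 / 3))) →
      (∀ q ∈ X \ P, -R < ⟪q, ν⟫_ℝ) →
      (∀ p ∈ P, ∀ q ∈ X \ P, dist p q = 1 →
        ∀ d ∈ ([barlowPos 1 (Real.sqrt (2 / 3)) constHagg 0 1 0, -barlowPos 1 (Real.sqrt (2 / 3)) constHagg 0 1 0,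
            barlowPos 1 (Real.sqrt (2 / 3)) constHagg 0 0 1, -barlowPos 1 (Real.sqrt (2 / 3)) constHagg 0 0 1,
            barlowPos 1 (Real.sqrt (2 / 3)) constHagg 0 1 (-1), -barlowPos 1 (Real.sqrt (2 / 3)) constHagg 0 1 (-1),
            barlowPos 1 (Real.sqrt (2 / 3)) constHagg 1 0 0, -barlowPos 1 (Real.sqrt (2 / 3)) constHagg 1 0 0,
            barlowPos 1 (Real.sqrt (2 / 3)) constHagg (-1) 1 0, -barlowPos 1 (Real.sqrt (2 / 3)) constHagg (-1) 1 0,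
            barlowPos 1 (Real.sqrt (2 / 3)) constHagg (-1) 0 1, -barlowPos 1 (Real.sqrt (2 / 3)) constHagg (-1) 0 1] :
            List (EuclideanSpace ℝ (Fin 3))),
          ⟪g d, ν⟫_ℝ < 0 → p + g d ∈ P) →
      ((((P ×ˢ (X \ P)).filter fun pq => dist pq.1 pq.2 = 1).card : ℕ) : ℝ) ≤
        contactDeficiency (X \ P) + C * ρ := by
  classical
  obtain ⟨R, C, hR, h⟩ := hT
  refine ⟨R, C, hR, fun ν hν ρ hρ X P hX hPX hP g hg hg' hreg hfilm habove hclos => ?_⟩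
  have hgi : Isometry (g.symm : EuclideanSpace ℝ (Fin 3) → EuclideanSpace ℝ (Fin 3)) := g.symm.isometry
  have hinj : Function.Injective (g.symm : EuclideanSpace ℝ (Fin 3) → EuclideanSpace ℝ (Fin 3)) :=
    g.symm.injective
  set X' := X.image g.symm with hX'
  set P' := P.image g.symm with hP'def
  set ν' := g.symm ν with hν'
  have hsd : X' \ P' = (X \ P).image g.symm := by
    rw [hX', hP'def, image_sdiff_of_injOn hinj.injOn hPX]
  have hXp : ∀ p ∈ X', ∀ q ∈ X', p ≠ q → 1 ≤ dist p q := by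
    intro p hp q hq hpq
    obtain ⟨p₀, hp₀, rfl⟩ := mem_image.1 hp
    obtain ⟨q₀, hq₀, rfl⟩ := mem_image.1 hq
    rw [hgi.dist_eq]
    exact hX p₀ hp₀ q₀ hq₀ fun e => hpq (by rw [e])
  have hPXp : P' ⊆ X' := image_subset_image hPX
  have hinn : ∀ p, ⟪g.symm p, ν'⟫_ℝ = ⟪p, ν⟫_ℝ := fun p => by
    rw [hν', LinearIsometryEquiv.inner_map_map]
  have hνn : ‖ν'‖ = 1 := by rw [hν', LinearIsometryEquiv.norm_map, hν]
  have hPp : ∀ p, p ∈ P' ↔ (p ∈ fccStacking 1 (Real.sqrt (2 / 3)) ∧ -(2 * R) ≤ ⟪p, ν'⟫_ℝ ∧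
      ⟪p, ν'⟫_ℝ ≤ -R ∧ ‖p‖ ^ 2 - ⟪p, ν'⟫_ℝ ^ 2 ≤ ρ ^ 2) := by
    intro p
    rw [hP'def, mem_image]
    constructor
    · rintro ⟨p₀, hp₀, rfl⟩
      obtain ⟨hΛ, h1, h2, h3⟩ := (hP p₀).1 hp₀
      refine ⟨hg' p₀ hΛ, ?_, ?_, ?_⟩
      · rw [hinn]; exact h1
      · rw [hinn]; exact h2
      · rw [hinn, LinearIsometryEquiv.norm_map]; exact h3
    · rintro ⟨hΛ, h1, h2, h3⟩
      have hi : ⟪g p, ν⟫_ℝ = ⟪p, ν'⟫_ℝ := by rw [← hinn (g p), LinearIsometryEquiv.symm_apply_apply]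
      refine ⟨g p, (hP (g p)).2 ⟨hg p hΛ, ?_, ?_, ?_⟩, g.symm_apply_apply p⟩
      · rw [hi]; exact h1
      · rw [hi]; exact h2
      · rw [hi, LinearIsometryEquiv.norm_map]; exact h3
  have hfilm' : ∀ q ∈ X' \ P', q ∈ fccStacking 1 (Real.sqrt (2 / 3)) ∨
      q - barlowOffset 1 ∈ fccStacking 1 (Real.sqrt (2 / 3)) ∨
      q + barlowOffset 1 ∈ fccStacking 1 (Real.sqrt (2 / 3)) := by
    intro q hq
    rw [hsd] at hq
    obtain ⟨q₀, hq₀, rfl⟩ := mem_image.1 hq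
    rcases hfilm q₀ hq₀ with h0 | h1 | h2
    · exact Or.inl (hg' q₀ h0)
    · refine Or.inr (Or.inl ?_)
      have : g.symm q₀ - barlowOffset 1 = g.symm (q₀ - g (barlowOffset 1)) := by
        rw [map_sub, LinearIsometryEquiv.symm_apply_apply]
      rw [this]; exact hg' _ h1
    · refine Or.inr (Or.inr ?_)
      have : g.symm q₀ + barlowOffset 1 = g.symm (q₀ + g (barlowOffset 1)) := by
        rw [map_add, LinearIsometryEquiv.symm_apply_apply]
      rw [this]; exact hg' _ h2
  have habove' : ∀ q ∈ X' \ P', -R < ⟪q, ν'⟫_ℝ := by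
    intro q hq
    rw [hsd] at hq
    obtain ⟨q₀, hq₀, rfl⟩ := mem_image.1 hq
    rw [hinn]; exact habove q₀ hq₀
  have hclos' : ∀ p ∈ P', ∀ q ∈ X' \ P', dist p q = 1 →
      ∀ d ∈ ([barlowPos 1 (Real.sqrt (2 / 3)) constHagg 0 1 0, -barlowPos 1 (Real.sqrt (2 / 3)) constHagg 0 1 0,
          barlowPos 1 (Real.sqrt (2 / 3)) constHagg 0 0 1, -barlowPos 1 (Real.sqrt (2 / 3)) constHagg 0 0 1,
          barlowPos 1 (Real.sqrt (2 / 3)) constHagg 0 1 (-1), -barlowPos 1 (Real.sqrt (2 / 3)) constHagg 0 1 (-1),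
          barlowPos 1 (Real.sqrt (2 / 3)) constHagg 1 0 0, -barlowPos 1 (Real.sqrt (2 / 3)) constHagg 1 0 0,
          barlowPos 1 (Real.sqrt (2 / 3)) constHagg (-1) 1 0, -barlowPos 1 (Real.sqrt (2 / 3)) constHagg (-1) 1 0,
          barlowPos 1 (Real.sqrt (2 / 3)) constHagg (-1) 0 1, -barlowPos 1 (Real.sqrt (2 / 3)) constHagg (-1) 0 1] :
          List (EuclideanSpace ℝ (Fin 3))),
        ⟪d, ν'⟫_ℝ < 0 → p + d ∈ P' := by
    intro p hp q hq hd d hdL hdν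
    rw [hsd] at hq
    obtain ⟨q₀, hq₀, rfl⟩ := mem_image.1 hq
    rw [hP'def] at hp ⊢
    obtain ⟨p₀, hp₀, rfl⟩ := mem_image.1 hp
    rw [hgi.dist_eq] at hd
    have hgd : ⟪g d, ν⟫_ℝ < 0 := by
      rw [← hinn (g d), LinearIsometryEquiv.symm_apply_apply]; exact hdν
    have := hclos p₀ hp₀ q₀ hq₀ hd d hdL hgd
    refine mem_image.2 ⟨p₀ + g d, this, ?_⟩
    rw [map_add, LinearIsometryEquiv.symm_apply_apply]
  have hmain := h ν' hνn ρ hρ X' P' hXp hPXp hPp hreg hfilm' habove' hclos'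
  rw [hsd, hP'def, card_cross_image_of_isometry hgi, contactDeficiency_image_of_isometry hgi] at hmain
  exact hmain

/-- **Regime `C = 0` for the family `g e₃`** (layer order along `g e₃`; registered by name). -/
theorem nTiltBarlowFilm_adhesion_orbit :
    ∃ R C : ℝ, 1 ≤ R ∧ ∀ ν : EuclideanSpace ℝ (Fin 3), ‖ν‖ = 1 → ∀ ρ : ℝ, R ≤ ρ →
      ∀ X P : Finset (EuclideanSpace ℝ (Fin 3)),
      (∀ p ∈ X, ∀ q ∈ X, p ≠ q → 1 ≤ dist p q) → P ⊆ X →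
      (∀ p, p ∈ P ↔ (p ∈ fccStacking 1 (Real.sqrt (2 / 3)) ∧ -(2 * R) ≤ ⟪p, ν⟫_ℝ ∧
        ⟪p, ν⟫_ℝ ≤ -R ∧ ‖p‖ ^ 2 - ⟪p, ν⟫_ℝ ^ 2 ≤ ρ ^ 2)) →
      ∀ g : EuclideanSpace ℝ (Fin 3) ≃ₗᵢ[ℝ] EuclideanSpace ℝ (Fin 3),
      (∀ p ∈ fccStacking 1 (Real.sqrt (2 / 3)), g p ∈ fccStacking 1 (Real.sqrt (2 / 3))) →
      (∀ p ∈ fccStacking 1 (Real.sqrt (2 / 3)), g.symm p ∈ fccStacking 1 (Real.sqrt (2 / 3))) →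
      (∀ τ ∈ ([barlowOffset 1, barlowOffset 1 - barlowPos 1 (Real.sqrt (2 / 3)) constHagg 0 1 0,
          barlowOffset 1 - barlowPos 1 (Real.sqrt (2 / 3)) constHagg 0 0 1] : List (EuclideanSpace ℝ (Fin 3))),
        0 < Real.sqrt (2 / 3) * ⟪ν, g (EuclideanSpace.single (2 : Fin 3) (1 : ℝ))⟫_ℝ + ⟪g τ, ν⟫_ℝ) →
      (∀ q ∈ X \ P, q ∈ fccStacking 1 (Real.sqrt (2 / 3)) ∨
        q - g (barlowOffset 1) ∈ fccStacking 1 (Real.sqrt (2 / 3)) ∨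
        q + g (barlowOffset 1) ∈ fccStacking 1 (Real.sqrt (2 / 3))) →
      (∀ q ∈ X \ P, -R < ⟪q, ν⟫_ℝ) →
      (∀ p ∈ P, ∀ q ∈ X \ P, dist p q = 1 →
        ∀ d ∈ ([barlowPos 1 (Real.sqrt (2 / 3)) constHagg 0 1 0, -barlowPos 1 (Real.sqrt (2 / 3)) constHagg 0 1 0,
            barlowPos 1 (Real.sqrt (2 / 3)) constHagg 0 0 1, -barlowPos 1 (Real.sqrt (2 / 3)) constHagg 0 0 1,
            barlowPos 1 (Real.sqrt (2 / 3)) constHagg 0 1 (-1), -barlowPos 1 (Real.sqrt (2 / 3)) constHagg 0 1 (-1),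
            barlowPos 1 (Real.sqrt (2 / 3)) constHagg 1 0 0, -barlowPos 1 (Real.sqrt (2 / 3)) constHagg 1 0 0,
            barlowPos 1 (Real.sqrt (2 / 3)) constHagg (-1) 1 0, -barlowPos 1 (Real.sqrt (2 / 3)) constHagg (-1) 1 0,
            barlowPos 1 (Real.sqrt (2 / 3)) constHagg (-1) 0 1, -barlowPos 1 (Real.sqrt (2 / 3)) constHagg (-1) 0 1] :
            List (EuclideanSpace ℝ (Fin 3))),
          ⟪g d, ν⟫_ℝ < 0 → p + g d ∈ P) →
      ((((P ×ˢ (X \ P)).filter fun pq => dist pq.1 pq.2 = 1).card : ℕ) : ℝ) ≤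
        contactDeficiency (X \ P) + C * ρ := by
  classical
  -- the closure-form version of `nTiltBarlowFilm_adhesion` with the twelve-vector list
  have hT := closureRung_transport
    (fun ν => ∀ τ ∈ ([barlowOffset 1, barlowOffset 1 - barlowPos 1 (Real.sqrt (2 / 3)) constHagg 0 1 0,
          barlowOffset 1 - barlowPos 1 (Real.sqrt (2 / 3)) constHagg 0 0 1] : List (EuclideanSpace ℝ (Fin 3))),
        0 < Real.sqrt (2 / 3) * ν 2 + ⟪τ, ν⟫_ℝ) (by
      obtain ⟨R, C, hR, h⟩ := nTiltBarlowFilm_adhesion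
      refine ⟨R, C, hR, fun ν hν ρ hρ X P hX hPX hP hreg hfilm habove hclos => ?_⟩
      refine h ν hν ρ hρ X P hX hPX hP hreg hfilm habove fun p hp q hq hd τ hτ => ?_
      -- `p − N − τ = p + d` for a bond vector `d` of the list, which is `ν`-downward in regime `C = 0`
      obtain ⟨e1, e2, e3, -, -, -⟩ := polar_vectors_eq
      have hNν : ⟪layerNormal (Real.sqrt (2 / 3)), ν⟫_ℝ = Real.sqrt (2 / 3) * ν 2 := inner_layerNormal_left ν
      have hpos := hreg τ hτ
      simp only [List.mem_cons, List.mem_nil_iff, or_false] at hτ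
      rcases hτ with rfl | rfl | rfl
      · rw [show p - layerNormal (Real.sqrt (2 / 3)) - barlowOffset 1 = p + -barlowPos 1 (Real.sqrt (2 / 3)) constHagg 1 0 0 by
          rw [e1]; abel]
        exact hclos p hp q hq hd _ (by simp) (by rw [inner_neg_left, e1, inner_add_left, hNν]; linarith)
      · rw [show p - layerNormal (Real.sqrt (2 / 3)) - (barlowOffset 1 - barlowPos 1 (Real.sqrt (2 / 3)) constHagg 0 1 0)
            = p + barlowPos 1 (Real.sqrt (2 / 3)) constHagg (-1) 1 0 by rw [e2]; abel]
        exact hclos p hp q hq hd _ (by simp) (by rw [e2, inner_neg_left, inner_add_left, hNν]; linarith)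
      · rw [show p - layerNormal (Real.sqrt (2 / 3)) - (barlowOffset 1 - barlowPos 1 (Real.sqrt (2 / 3)) constHagg 0 0 1)
            = p + barlowPos 1 (Real.sqrt (2 / 3)) constHagg (-1) 0 1 by rw [e3]; abel]
        exact hclos p hp q hq hd _ (by simp) (by rw [e3, inner_neg_left, inner_add_left, hNν]; linarith))
  obtain ⟨R, C, hR, h⟩ := hT
  refine ⟨R, C, hR, fun ν hν ρ hρ X P hX hPX hP g hg hg' hreg => h ν hν ρ hρ X P hX hPX hP g hg hg' ?_⟩
  -- the regime read through `g`
  have e2 : (g.symm ν) 2 = ⟪ν, g (EuclideanSpace.single (2 : Fin 3) (1 : ℝ))⟫_ℝ := by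
    have : ⟪g.symm ν, EuclideanSpace.single (2 : Fin 3) (1 : ℝ)⟫_ℝ = (g.symm ν) 2 := by
      simp [EuclideanSpace.inner_single_right]
    rw [← this, ← g.inner_map_map, LinearIsometryEquiv.apply_symm_apply]
  have et : ∀ τ : EuclideanSpace ℝ (Fin 3), ⟪τ, g.symm ν⟫_ℝ = ⟪g τ, ν⟫_ℝ := fun τ => by
    rw [← g.inner_map_map, LinearIsometryEquiv.apply_symm_apply]
  intro τ hτ
  rw [e2, et]
  exact hreg τ hτ


/-- **Regime `C = 1` for the family `g e₃`** (the `A`-rule flow; registered by name). -/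
theorem oneOverhangBarlowFilm_adhesion_orbit :
    ∃ R C : ℝ, 1 ≤ R ∧ ∀ ν : EuclideanSpace ℝ (Fin 3), ‖ν‖ = 1 → ∀ ρ : ℝ, R ≤ ρ →
      ∀ X P : Finset (EuclideanSpace ℝ (Fin 3)),
      (∀ p ∈ X, ∀ q ∈ X, p ≠ q → 1 ≤ dist p q) → P ⊆ X →
      (∀ p, p ∈ P ↔ (p ∈ fccStacking 1 (Real.sqrt (2 / 3)) ∧ -(2 * R) ≤ ⟪p, ν⟫_ℝ ∧
        ⟪p, ν⟫_ℝ ≤ -R ∧ ‖p‖ ^ 2 - ⟪p, ν⟫_ℝ ^ 2 ≤ ρ ^ 2)) →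
      ∀ g : EuclideanSpace ℝ (Fin 3) ≃ₗᵢ[ℝ] EuclideanSpace ℝ (Fin 3),
      (∀ p ∈ fccStacking 1 (Real.sqrt (2 / 3)), g p ∈ fccStacking 1 (Real.sqrt (2 / 3))) →
      (∀ p ∈ fccStacking 1 (Real.sqrt (2 / 3)), g.symm p ∈ fccStacking 1 (Real.sqrt (2 / 3))) →
      0 ≤ ⟪ν, g (EuclideanSpace.single (2 : Fin 3) (1 : ℝ))⟫_ℝ →
      ((Real.sqrt (2 / 3) * ⟪ν, g (EuclideanSpace.single (2 : Fin 3) (1 : ℝ))⟫_ℝ + ⟪g (barlowOffset 1), ν⟫_ℝ < 0 ∧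
          0 < Real.sqrt (2 / 3) * ⟪ν, g (EuclideanSpace.single (2 : Fin 3) (1 : ℝ))⟫_ℝ + ⟪g (barlowOffset 1 - barlowPos 1 (Real.sqrt (2 / 3)) constHagg 0 1 0), ν⟫_ℝ ∧
          0 < Real.sqrt (2 / 3) * ⟪ν, g (EuclideanSpace.single (2 : Fin 3) (1 : ℝ))⟫_ℝ + ⟪g (barlowOffset 1 - barlowPos 1 (Real.sqrt (2 / 3)) constHagg 0 0 1), ν⟫_ℝ) ∨
        (Real.sqrt (2 / 3) * ⟪ν, g (EuclideanSpace.single (2 : Fin 3) (1 : ℝ))⟫_ℝ + ⟪g (barlowOffset 1 - barlowPos 1 (Real.sqrt (2 / 3)) constHagg 0 1 0), ν⟫_ℝ < 0 ∧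
          0 < Real.sqrt (2 / 3) * ⟪ν, g (EuclideanSpace.single (2 : Fin 3) (1 : ℝ))⟫_ℝ + ⟪g (barlowOffset 1), ν⟫_ℝ ∧
          0 < Real.sqrt (2 / 3) * ⟪ν, g (EuclideanSpace.single (2 : Fin 3) (1 : ℝ))⟫_ℝ + ⟪g (barlowOffset 1 - barlowPos 1 (Real.sqrt (2 / 3)) constHagg 0 0 1), ν⟫_ℝ) ∨
        (Real.sqrt (2 / 3) * ⟪ν, g (EuclideanSpace.single (2 : Fin 3) (1 : ℝ))⟫_ℝ + ⟪g (barlowOffset 1 - barlowPos 1 (Real.sqrt (2 / 3)) constHagg 0 0 1), ν⟫_ℝ < 0 ∧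
          0 < Real.sqrt (2 / 3) * ⟪ν, g (EuclideanSpace.single (2 : Fin 3) (1 : ℝ))⟫_ℝ + ⟪g (barlowOffset 1), ν⟫_ℝ ∧
          0 < Real.sqrt (2 / 3) * ⟪ν, g (EuclideanSpace.single (2 : Fin 3) (1 : ℝ))⟫_ℝ + ⟪g (barlowOffset 1 - barlowPos 1 (Real.sqrt (2 / 3)) constHagg 0 1 0), ν⟫_ℝ)) →
      (∀ q ∈ X \ P, q ∈ fccStacking 1 (Real.sqrt (2 / 3)) ∨
        q - g (barlowOffset 1) ∈ fccStacking 1 (Real.sqrt (2 / 3)) ∨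
        q + g (barlowOffset 1) ∈ fccStacking 1 (Real.sqrt (2 / 3))) →
      (∀ q ∈ X \ P, -R < ⟪q, ν⟫_ℝ) →
      (∀ p ∈ P, ∀ q ∈ X \ P, dist p q = 1 →
        ∀ d ∈ ([barlowPos 1 (Real.sqrt (2 / 3)) constHagg 0 1 0, -barlowPos 1 (Real.sqrt (2 / 3)) constHagg 0 1 0,
            barlowPos 1 (Real.sqrt (2 / 3)) constHagg 0 0 1, -barlowPos 1 (Real.sqrt (2 / 3)) constHagg 0 0 1,
            barlowPos 1 (Real.sqrt (2 / 3)) constHagg 0 1 (-1), -barlowPos 1 (Real.sqrt (2 / 3)) constHagg 0 1 (-1),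
            barlowPos 1 (Real.sqrt (2 / 3)) constHagg 1 0 0, -barlowPos 1 (Real.sqrt (2 / 3)) constHagg 1 0 0,
            barlowPos 1 (Real.sqrt (2 / 3)) constHagg (-1) 1 0, -barlowPos 1 (Real.sqrt (2 / 3)) constHagg (-1) 1 0,
            barlowPos 1 (Real.sqrt (2 / 3)) constHagg (-1) 0 1, -barlowPos 1 (Real.sqrt (2 / 3)) constHagg (-1) 0 1] :
            List (EuclideanSpace ℝ (Fin 3))),
          ⟪g d, ν⟫_ℝ < 0 → p + g d ∈ P) →
      ((((P ×ˢ (X \ P)).filter fun pq => dist pq.1 pq.2 = 1).card : ℕ) : ℝ) ≤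
        contactDeficiency (X \ P) + C * ρ := by
  classical
  have hT := closureRung_transport
    (fun ν => 0 ≤ ν 2 ∧ (((Real.sqrt (2 / 3) * ν 2 + ⟪barlowOffset 1, ν⟫_ℝ < 0 ∧
          0 < Real.sqrt (2 / 3) * ν 2 + ⟪barlowOffset 1 - barlowPos 1 (Real.sqrt (2 / 3)) constHagg 0 1 0, ν⟫_ℝ ∧
          0 < Real.sqrt (2 / 3) * ν 2 + ⟪barlowOffset 1 - barlowPos 1 (Real.sqrt (2 / 3)) constHagg 0 0 1, ν⟫_ℝ) ∨
        (Real.sqrt (2 / 3) * ν 2 + ⟪barlowOffset 1 - barlowPos 1 (Real.sqrt (2 / 3)) constHagg 0 1 0, ν⟫_ℝ < 0 ∧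
          0 < Real.sqrt (2 / 3) * ν 2 + ⟪barlowOffset 1, ν⟫_ℝ ∧
          0 < Real.sqrt (2 / 3) * ν 2 + ⟪barlowOffset 1 - barlowPos 1 (Real.sqrt (2 / 3)) constHagg 0 0 1, ν⟫_ℝ) ∨
        (Real.sqrt (2 / 3) * ν 2 + ⟪barlowOffset 1 - barlowPos 1 (Real.sqrt (2 / 3)) constHagg 0 0 1, ν⟫_ℝ < 0 ∧
          0 < Real.sqrt (2 / 3) * ν 2 + ⟪barlowOffset 1, ν⟫_ℝ ∧
          0 < Real.sqrt (2 / 3) * ν 2 + ⟪barlowOffset 1 - barlowPos 1 (Real.sqrt (2 / 3)) constHagg 0 1 0, ν⟫_ℝ)))) (by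
      obtain ⟨R, C, hR, h⟩ := oneOverhangBarlowFilm_adhesion
      exact ⟨R, C, hR, fun ν hν ρ hρ X P hX hPX hP hreg hfilm habove hclos =>
        h ν hν ρ hρ X P hX hPX hP hreg.1 hreg.2 hfilm habove hclos⟩)
  obtain ⟨R, C, hR, h⟩ := hT
  refine ⟨R, C, hR, fun ν hν ρ hρ X P hX hPX hP g hg hg' h0 hreg => h ν hν ρ hρ X P hX hPX hP g hg hg' ?_⟩
  have e2 : (g.symm ν) 2 = ⟪ν, g (EuclideanSpace.single (2 : Fin 3) (1 : ℝ))⟫_ℝ := by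
    have : ⟪g.symm ν, EuclideanSpace.single (2 : Fin 3) (1 : ℝ)⟫_ℝ = (g.symm ν) 2 := by
      simp [EuclideanSpace.inner_single_right]
    rw [← this, ← g.inner_map_map, LinearIsometryEquiv.apply_symm_apply]
  have et : ∀ τ : EuclideanSpace ℝ (Fin 3), ⟪τ, g.symm ν⟫_ℝ = ⟪g τ, ν⟫_ℝ := fun τ => by
    rw [← g.inner_map_map, LinearIsometryEquiv.apply_symm_apply]
  refine ⟨by rw [e2]; exact h0, ?_⟩
  simp only [et, e2]
  exact hreg

/-- **Regime `C = 2` for the family `g e₃`** (the `M`-rule flow; registered by name). -/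
theorem twoOverhangBarlowFilm_adhesion_orbit :
    ∃ R C : ℝ, 1 ≤ R ∧ ∀ ν : EuclideanSpace ℝ (Fin 3), ‖ν‖ = 1 → ∀ ρ : ℝ, R ≤ ρ →
      ∀ X P : Finset (EuclideanSpace ℝ (Fin 3)),
      (∀ p ∈ X, ∀ q ∈ X, p ≠ q → 1 ≤ dist p q) → P ⊆ X →
      (∀ p, p ∈ P ↔ (p ∈ fccStacking 1 (Real.sqrt (2 / 3)) ∧ -(2 * R) ≤ ⟪p, ν⟫_ℝ ∧
        ⟪p, ν⟫_ℝ ≤ -R ∧ ‖p‖ ^ 2 - ⟪p, ν⟫_ℝ ^ 2 ≤ ρ ^ 2)) →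
      ∀ g : EuclideanSpace ℝ (Fin 3) ≃ₗᵢ[ℝ] EuclideanSpace ℝ (Fin 3),
      (∀ p ∈ fccStacking 1 (Real.sqrt (2 / 3)), g p ∈ fccStacking 1 (Real.sqrt (2 / 3))) →
      (∀ p ∈ fccStacking 1 (Real.sqrt (2 / 3)), g.symm p ∈ fccStacking 1 (Real.sqrt (2 / 3))) →
      0 ≤ ⟪ν, g (EuclideanSpace.single (2 : Fin 3) (1 : ℝ))⟫_ℝ →
      ((0 < Real.sqrt (2 / 3) * ⟪ν, g (EuclideanSpace.single (2 : Fin 3) (1 : ℝ))⟫_ℝ + ⟪g (barlowOffset 1), ν⟫_ℝ ∧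
          Real.sqrt (2 / 3) * ⟪ν, g (EuclideanSpace.single (2 : Fin 3) (1 : ℝ))⟫_ℝ + ⟪g (barlowOffset 1 - barlowPos 1 (Real.sqrt (2 / 3)) constHagg 0 1 0), ν⟫_ℝ < 0 ∧
          Real.sqrt (2 / 3) * ⟪ν, g (EuclideanSpace.single (2 : Fin 3) (1 : ℝ))⟫_ℝ + ⟪g (barlowOffset 1 - barlowPos 1 (Real.sqrt (2 / 3)) constHagg 0 0 1), ν⟫_ℝ < 0) ∨
        (0 < Real.sqrt (2 / 3) * ⟪ν, g (EuclideanSpace.single (2 : Fin 3) (1 : ℝ))⟫_ℝ + ⟪g (barlowOffset 1 - barlowPos 1 (Real.sqrt (2 / 3)) constHagg 0 1 0), ν⟫_ℝ ∧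
          Real.sqrt (2 / 3) * ⟪ν, g (EuclideanSpace.single (2 : Fin 3) (1 : ℝ))⟫_ℝ + ⟪g (barlowOffset 1), ν⟫_ℝ < 0 ∧
          Real.sqrt (2 / 3) * ⟪ν, g (EuclideanSpace.single (2 : Fin 3) (1 : ℝ))⟫_ℝ + ⟪g (barlowOffset 1 - barlowPos 1 (Real.sqrt (2 / 3)) constHagg 0 0 1), ν⟫_ℝ < 0) ∨
        (0 < Real.sqrt (2 / 3) * ⟪ν, g (EuclideanSpace.single (2 : Fin 3) (1 : ℝ))⟫_ℝ + ⟪g (barlowOffset 1 - barlowPos 1 (Real.sqrt (2 / 3)) constHagg 0 0 1), ν⟫_ℝ ∧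
          Real.sqrt (2 / 3) * ⟪ν, g (EuclideanSpace.single (2 : Fin 3) (1 : ℝ))⟫_ℝ + ⟪g (barlowOffset 1), ν⟫_ℝ < 0 ∧
          Real.sqrt (2 / 3) * ⟪ν, g (EuclideanSpace.single (2 : Fin 3) (1 : ℝ))⟫_ℝ + ⟪g (barlowOffset 1 - barlowPos 1 (Real.sqrt (2 / 3)) constHagg 0 1 0), ν⟫_ℝ < 0)) →
      (∀ q ∈ X \ P, q ∈ fccStacking 1 (Real.sqrt (2 / 3)) ∨
        q - g (barlowOffset 1) ∈ fccStacking 1 (Real.sqrt (2 / 3)) ∨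
        q + g (barlowOffset 1) ∈ fccStacking 1 (Real.sqrt (2 / 3))) →
      (∀ q ∈ X \ P, -R < ⟪q, ν⟫_ℝ) →
      (∀ p ∈ P, ∀ q ∈ X \ P, dist p q = 1 →
        ∀ d ∈ ([barlowPos 1 (Real.sqrt (2 / 3)) constHagg 0 1 0, -barlowPos 1 (Real.sqrt (2 / 3)) constHagg 0 1 0,
            barlowPos 1 (Real.sqrt (2 / 3)) constHagg 0 0 1, -barlowPos 1 (Real.sqrt (2 / 3)) constHagg 0 0 1,
            barlowPos 1 (Real.sqrt (2 / 3)) constHagg 0 1 (-1), -barlowPos 1 (Real.sqrt (2 / 3)) constHagg 0 1 (-1),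
            barlowPos 1 (Real.sqrt (2 / 3)) constHagg 1 0 0, -barlowPos 1 (Real.sqrt (2 / 3)) constHagg 1 0 0,
            barlowPos 1 (Real.sqrt (2 / 3)) constHagg (-1) 1 0, -barlowPos 1 (Real.sqrt (2 / 3)) constHagg (-1) 1 0,
            barlowPos 1 (Real.sqrt (2 / 3)) constHagg (-1) 0 1, -barlowPos 1 (Real.sqrt (2 / 3)) constHagg (-1) 0 1] :
            List (EuclideanSpace ℝ (Fin 3))),
          ⟪g d, ν⟫_ℝ < 0 → p + g d ∈ P) →
      ((((P ×ˢ (X \ P)).filter fun pq => dist pq.1 pq.2 = 1).card : ℕ) : ℝ) ≤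
        contactDeficiency (X \ P) + C * ρ := by
  classical
  have hT := closureRung_transport
    (fun ν => 0 ≤ ν 2 ∧ (((0 < Real.sqrt (2 / 3) * ν 2 + ⟪barlowOffset 1, ν⟫_ℝ ∧
          Real.sqrt (2 / 3) * ν 2 + ⟪barlowOffset 1 - barlowPos 1 (Real.sqrt (2 / 3)) constHagg 0 1 0, ν⟫_ℝ < 0 ∧
          Real.sqrt (2 / 3) * ν 2 + ⟪barlowOffset 1 - barlowPos 1 (Real.sqrt (2 / 3)) constHagg 0 0 1, ν⟫_ℝ < 0) ∨
        (0 < Real.sqrt (2 / 3) * ν 2 + ⟪barlowOffset 1 - barlowPos 1 (Real.sqrt (2 / 3)) constHagg 0 1 0, ν⟫_ℝ ∧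
          Real.sqrt (2 / 3) * ν 2 + ⟪barlowOffset 1, ν⟫_ℝ < 0 ∧
          Real.sqrt (2 / 3) * ν 2 + ⟪barlowOffset 1 - barlowPos 1 (Real.sqrt (2 / 3)) constHagg 0 0 1, ν⟫_ℝ < 0) ∨
        (0 < Real.sqrt (2 / 3) * ν 2 + ⟪barlowOffset 1 - barlowPos 1 (Real.sqrt (2 / 3)) constHagg 0 0 1, ν⟫_ℝ ∧
          Real.sqrt (2 / 3) * ν 2 + ⟪barlowOffset 1, ν⟫_ℝ < 0 ∧
          Real.sqrt (2 / 3) * ν 2 + ⟪barlowOffset 1 - barlowPos 1 (Real.sqrt (2 / 3)) constHagg 0 1 0, ν⟫_ℝ < 0)))) (by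
      obtain ⟨R, C, hR, h⟩ := twoOverhangBarlowFilm_adhesion
      exact ⟨R, C, hR, fun ν hν ρ hρ X P hX hPX hP hreg hfilm habove hclos =>
        h ν hν ρ hρ X P hX hPX hP hreg.1 hreg.2 hfilm habove hclos⟩)
  obtain ⟨R, C, hR, h⟩ := hT
  refine ⟨R, C, hR, fun ν hν ρ hρ X P hX hPX hP g hg hg' h0 hreg => h ν hν ρ hρ X P hX hPX hP g hg hg' ?_⟩
  have e2 : (g.symm ν) 2 = ⟪ν, g (EuclideanSpace.single (2 : Fin 3) (1 : ℝ))⟫_ℝ := by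
    have : ⟪g.symm ν, EuclideanSpace.single (2 : Fin 3) (1 : ℝ)⟫_ℝ = (g.symm ν) 2 := by
      simp [EuclideanSpace.inner_single_right]
    rw [← this, ← g.inner_map_map, LinearIsometryEquiv.apply_symm_apply]
  have et : ∀ τ : EuclideanSpace ℝ (Fin 3), ⟪τ, g.symm ν⟫_ℝ = ⟪g τ, ν⟫_ℝ := fun τ => by
    rw [← g.inner_map_map, LinearIsometryEquiv.apply_symm_apply]
  refine ⟨by rw [e2]; exact h0, ?_⟩
  simp only [et, e2]
  exact hreg

end Summit.Ventures.Crystal3D.Theorems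

end
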